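import Mathlib.Analysis.SpecialFunctions.Pow.Real
import Mathlib.Tactic.Linarith
import Mathlib.Tactic.Positivity
import Mathlib.Tactic.Ring
import HarnessLib

/-!
# `NoHeavyLowerTail` (stmt-CriticalPhenomena-4575) — APL, geometric form: two more closure operations (pendant target,
# `b–c` edge) in cell form

Support file (prover prim-ineq-gen-8 gen 29; `--supports stmt-CriticalPhenomena-4575`; memo
run/shared/lean/prim/prim-ineq-gen-8/FINDING-gen29-APL-GEOMETRIC.md §2).  Companion of
`…Theorems/PercNearOneGluingNoHeavyLowerTailAPLGeometricClosure.lean` (piece-union at the apex = `geom_compose_sq`,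
pendant apex = `geom_scale`, cell identities `harrisDefect_eq_cells` / `gzDefect_eq_cells`).  Pure real algebra, no sorries.

Cells `(u0, uab, uac, ubc, u3) = (P(a|b|c), P(ab|c), P(ac|b), P(a|bc), P(abc))` of an instance `(a; b, c)` (summing to `1`);
defect `Δ := u0·u3 − (uab+uac)·ubc = T·D − e`.  APL-G is: `0 ≤ Δ` (Harris) and `Δ² ≤ uab·uac`.
* `geom_pendant_target` — hang a new vertex `b'` on `b` by one edge of weight `w ∈ [0,1]` and consider `(a; b', c)`:
  new cells `u0' = u0 + (1−w)(uab + ubc)`, `uab' = w·uab`, `uac' = uac + (1−w)·u3`, `ubc' = w·ubc`, `u3' = w·u3`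
  (edge closed: `b'` is isolated; edge open: `b' ≡ b`), and `Δ' = w·(Δ + (1−w)·uab·(ubc+u3))`.  Using only Harris'
  inequality `P(a↔b)·P(b↔c) ≤ P(abc)`, i.e. `(uab+u3)(ubc+u3) ≤ u3`, APL-G passes from `(a;b,c)` to `(a;b',c)`.
  Consequently a minimal counterexample to APL-G has `deg b ≥ 2` and `deg c ≥ 2` (memo §2, reduction R5).
* `geom_bc_edge` — a `b–c` edge of weight `p`: `u0' = (1−p)u0`, `uab' = (1−p)uab`, `uac' = (1−p)uac`, `ubc' = ubc + p·u0`,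
  `u3' = u3 + p(uab+uac)`; `Δ' = (1−p)Δ`, so APL-G is invariant.
(Internal vertices of degree ≤ 2 and parallel edges are suppressed without changing any cell — no algebra needed.)
[folklore algebra; the percolation meaning is in the memo]
-/

namespace Summit.CriticalPhenomena.PercolationContinuityZ3.Theorems

namespace APL

/-- APL-G is preserved by a pendant TARGET extension `b ↦ b'–b` (weight `w ∈ [0,1]`), given Harris' inequality
`(uab+u3)(ubc+u3) ≤ u3` for the old instance (cells nonnegative, summing to `1`). [folklore] -/
theorem geom_pendant_target (u0 uab uac ubc u3 w : ℝ) (h0 : 0 ≤ u0) (hab : 0 ≤ uab) (hac : 0 ≤ uac) (hbc : 0 ≤ ubc)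
    (h3 : 0 ≤ u3) (hsum : u0 + uab + uac + ubc + u3 = 1)
    (hw₀ : 0 ≤ w) (hw₁ : w ≤ 1) (hH : (uab + u3) * (ubc + u3) ≤ u3)
    (hΔ₀ : 0 ≤ u0 * u3 - (uab + uac) * ubc) (hΔ : (u0 * u3 - (uab + uac) * ubc)^2 ≤ uab * uac) :
    0 ≤ (u0 + (1 - w) * (uab + ubc)) * (w * u3) - (w * uab + (uac + (1 - w) * u3)) * (w * ubc) ∧
    ((u0 + (1 - w) * (uab + ubc)) * (w * u3) - (w * uab + (uac + (1 - w) * u3)) * (w * ubc))^2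
      ≤ (w * uab) * (uac + (1 - w) * u3) := by
  set Δ := u0 * u3 - (uab + uac) * ubc with hΔdef
  set P := ubc + u3 with hPdef
  have hP0 : 0 ≤ P := by rw [hPdef]; linarith
  have hP1 : P ≤ 1 := by rw [hPdef]; linarith
  have hK : uab * P ≤ u3 := by rw [hPdef]; nlinarith [mul_nonneg h3 hbc, mul_nonneg h3 h3]
  have e0 : (u0 + (1 - w) * (uab + ubc)) * (w * u3) - (w * uab + (uac + (1 - w) * u3)) * (w * ubc)
      = w * (Δ + (1 - w) * (uab * P)) := by
    rw [hΔdef, hPdef]; ring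
  have hw1' : 0 ≤ 1 - w := by linarith
  have hin : 0 ≤ Δ + (1 - w) * (uab * P) := by
    have := mul_nonneg hw1' (mul_nonneg hab hP0); linarith
  refine ⟨by rw [e0]; exact mul_nonneg hw₀ hin, ?_⟩
  rw [e0]
  -- (Δ·P)² ≤ u3·uac, hence 2·Δ·P ≤ u3 + uac
  have hΔP : (Δ * P)^2 ≤ ((u3 + uac) / 2)^2 := by
    have h1 : (Δ * P)^2 ≤ (uab * uac) * P^2 := by
      rw [mul_pow]; exact mul_le_mul_of_nonneg_right hΔ (sq_nonneg P)
    have h2 : (uab * uac) * P^2 ≤ u3 * uac := by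
      have h21 : (uab * uac) * P^2 = (uab * P) * (uac * P) := by ring
      rw [h21]
      exact mul_le_mul hK (mul_le_of_le_one_right hac hP1) (mul_nonneg hac hP0) h3
    nlinarith [sq_nonneg (u3 - uac)]
  have hΔP' : Δ * P ≤ (u3 + uac) / 2 :=
    le_trans (le_abs_self _) (abs_le_of_sq_le_sq hΔP (by linarith))
  have hKP : uab * P^2 ≤ u3 := by
    have : uab * P^2 = (uab * P) * P := by ring
    rw [this]; exact le_trans (mul_le_of_le_one_right (mul_nonneg hab hP0) hP1) hK
  -- key identity
  have e1 : (w * uab) * (uac + (1 - w) * u3) - (w * (Δ + (1 - w) * (uab * P)))^2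
      = w * (1 - w) * uab * ((uac + u3) - (2 * w * (Δ * P) + w * (1 - w) * (uab * P^2)))
        + w^2 * (uab * uac - Δ^2) := by ring
  have hb : 0 ≤ (uac + u3) - (2 * w * (Δ * P) + w * (1 - w) * (uab * P^2)) := by
    have t1 : w * (Δ * P) ≤ w * ((u3 + uac) / 2) := mul_le_mul_of_nonneg_left hΔP' hw₀
    have t2 : w * (1 - w) * (uab * P^2) ≤ w * (1 - w) * u3 :=
      mul_le_mul_of_nonneg_left hKP (mul_nonneg hw₀ hw1')
    have t3 : 0 ≤ (1 - w) * uac := mul_nonneg hw1' hac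
    have t4 : 0 ≤ (1 - w)^2 * u3 := mul_nonneg (sq_nonneg _) h3
    nlinarith [t1, t2, t3, t4]
  have hpos : 0 ≤ w * (1 - w) * uab * ((uac + u3) - (2 * w * (Δ * P) + w * (1 - w) * (uab * P^2)))
        + w^2 * (uab * uac - Δ^2) := by
    have := mul_nonneg (mul_nonneg (mul_nonneg hw₀ hw1') hab) hb
    have := mul_nonneg (sq_nonneg w) (sub_nonneg.mpr hΔ)
    linarith
  linarith [e1, hpos]

/-- APL-G is invariant under a `b–c` edge of weight `p ∈ [0,1]`: the defect and `sqrt(uab·uac)` both scale by `1 − p`.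
[folklore] -/
theorem geom_bc_edge (u0 uab uac ubc u3 p : ℝ) (hp₁ : p ≤ 1)
    (hΔ₀ : 0 ≤ u0 * u3 - (uab + uac) * ubc) (hΔ : (u0 * u3 - (uab + uac) * ubc)^2 ≤ uab * uac) :
    0 ≤ ((1 - p) * u0) * (u3 + p * (uab + uac)) - ((1 - p) * uab + (1 - p) * uac) * (ubc + p * u0) ∧
    (((1 - p) * u0) * (u3 + p * (uab + uac)) - ((1 - p) * uab + (1 - p) * uac) * (ubc + p * u0))^2
      ≤ ((1 - p) * uab) * ((1 - p) * uac) := by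
  have e : ((1 - p) * u0) * (u3 + p * (uab + uac)) - ((1 - p) * uab + (1 - p) * uac) * (ubc + p * u0)
      = (1 - p) * (u0 * u3 - (uab + uac) * ubc) := by ring
  rw [e]
  have hq : 0 ≤ 1 - p := by linarith
  refine ⟨mul_nonneg hq hΔ₀, ?_⟩
  have e2 : ((1 - p) * uab) * ((1 - p) * uac) = (1 - p)^2 * (uab * uac) := by ring
  rw [mul_pow, e2]
  exact mul_le_mul_of_nonneg_left hΔ (sq_nonneg _)

end APL

end Summit.CriticalPhenomena.PercolationContinuityZ3.Theorems
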